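import Mathlib
import Summits.CriticalPhenomena.CardyFormulaZ2.Theorems.CardyMagicRigidityDefs
import Summits.CriticalPhenomena.CardyFormulaZ2.Theorems.CardyMagicRigidityNestingRigidityDomainEnsembleSupport
import Summits.CriticalPhenomena.CardyFormulaZ2.Theorems.CardyMagicRigidityNestingRigidityTowerIndependence
import Literature.Probability.Percolation.AnnulusCrossingBoundProofs
import Literature.Probability.Percolation.TriAnnulusCrossingProofs
import Literature.Probability.Percolation.TriAnnulusArms
import Literature.Probability.Percolation.MacroscopicInterfaceLoop
import Literature.Probability.Percolation.QuadCrossingMeasurability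
import Literature.Probability.Percolation.NestingWeightMeasurable
import Literature.Probability.Percolation.FullPlaneCNLProofs
import Literature.Probability.Percolation.LoopRotationInvarianceProofs
import HarnessLib

/-!
# Crux `NestingRigidity`, line `ring-cloud-tomography` (r4): gap crossings are rare UNDER THE TOWER
# TILT (input (G) of stub R2' `stub_staircaseDecoupling`, tilted form, both lattices)

Crux `Summit.CriticalPhenomena.CardyFormulaZ2.Theses.CardyMagicRigidity.NestingRigidity`
(stmt-CriticalPhenomena-4835), line `ring-cloud-tomography`, skeleton r4, stub R2'.  Sequel to
`…GapCrossing` (p117337: `P{some loop of X_δ meets B̄(x,a) and ℂ ∖ B(x,b)} ≤ C (a/b)^c`).  The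
decoupling pairs this gap-crossing event with the TILT `u^{N_x(ρ,R)}` of a tower in a window `B(x, R)`,
`R ≤ a`, inside the hole of the gap annulus; this file proves the pairing is harmless:
* §1–§2 **confinement**: on `δℤ²` (resp. `δ𝕋`) a crossing loop yields an open crossing through sites
  `s` with `a + δ < dist(δs, x) ≤ b + δ` (resp. `≤ b − δ`) — the rim walk of `…GapCrossing` trimmed at
  its last visit to `B̄(x, a + δ)` and at its first exit — a CYLINDER event of the annulus coordinates
  (`determinedBy_conf_zEns/_tEns`), inside the tree's RSW events `annulusOpenCrossing`/`triAnnulusCrossing`;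
* §3–§4 **independence ⇒ tilted rarity** (registered anchor
  `setIntegral_pow_towerCount_loop_cross_le_latticeEnsembles`): window observables are independent of
  the confined crossing (`TowerIndependence.indepFun_of_determined_zEns/_tEns` and the cylinder property
  of towers), so `∫_{gap crossed} u^{N_x(ρ,R)} ≤ C (a/b)^c · E[u^{N_x(ρ,R)}]` (`u ≥ 0`, `R ≤ a`, `4a ≤ b`,
  `c₀δ ≤ a`) on both lattice ensembles, by the PROVED RSW bounds `annulusOpenCrossing_half_le_holds`,
  `tri_annulusCrossing_bound_holds`.
-/

noncomputable section

open MeasureTheory ProbabilityTheory Set Filter Metric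
open scoped Real Topology BigOperators ENNReal

namespace Summit.CriticalPhenomena.CardyFormulaZ2.Cruxes.NestingRigidity.RingCloudTomography

open Literature.Probability.RandomPlanarGeometry Literature.Probability.Percolation
  Literature.Probability.LatticeModels
open Summit.CriticalPhenomena.CardyFormulaZ2.Cruxes.NestingRigidity.MarkovCascadeOneGeneration
  (exists_left_dist_le_mesh dist_meshPoint_medialPoint_le)

-- Local notation: the gap-crossing event; annulus sites and confined crossings on `δℤ²` and `δ𝕋`.
local notation3 "LCross(" E ", " δ ", " x ", " a ", " b ")" =>
  {ω | ∃ v ∈ (LoopEnsemble.X E δ ω).loops, (v.range ∩ closedBall x a).Nonempty ∧ (v.range ∩ (ball x b)ᶜ).Nonempty}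
local notation3 "ZAnn(" δ ", " x ", " a ", " b ")" =>
  {s : Site 2 | a + δ < dist (meshPoint δ s) x ∧ dist (meshPoint δ s) x ≤ b + δ}
local notation3 "ZConf(" δ ", " x ", " a ", " b ")" =>
  {ω : BondConfig (Site 2) | (ω ∩ (zdGraph 2).edgeSet : BondConfig (Site 2)) ∈
    openCrossing ZAnn(δ, x, a, b) {s : Site 2 | dist (meshPoint δ s) x ≤ a + 2 * δ}
      {s : Site 2 | b - δ ≤ dist (meshPoint δ s) x}}
local notation3 "TAnn(" δ ", " z ", " a ", " b ")" =>
  {s : Site 2 | a + δ < ‖triMeshPoint δ s - z‖ ∧ ‖triMeshPoint δ s - z‖ ≤ b - δ}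
local notation3 "TConf(" δ ", " z ", " a ", " b ")" =>
  {ω : SiteConfig (Site 2) | ∃ (p q : Site 2) (w : triGraph.Walk p q),
    ‖triMeshPoint δ p - z‖ < a + 3 * δ ∧ b - 2 * δ < ‖triMeshPoint δ q - z‖ ∧
    ∀ s ∈ w.support, s ∈ ω ∧ a + δ < ‖triMeshPoint δ s - z‖ ∧ ‖triMeshPoint δ s - z‖ ≤ b - δ}

namespace GapCrossing

/-! ## §1 Bond-`ℤ²`: the crossing loop gives an open crossing CONFINED to the annulus -/

/-- **Last visit.** A walk ending outside `D` either avoids `D`, or splits at its last visit to `D`. -/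
theorem walk_avoid_or_lastExit {V : Type*} {G : SimpleGraph V} (D : Set V) : ∀ {u v : V} (W : G.Walk u v), v ∉ D →
    (∀ z ∈ W.support, z ∉ D) ∨ ∃ (u₀ u₁ : V) (W' : G.Walk u₁ v), u₀ ∈ D ∧ G.Adj u₀ u₁ ∧ ∀ z ∈ W'.support, z ∉ D
  | _, _, SimpleGraph.Walk.nil, hv => Or.inl fun z hz ↦ by
      rw [SimpleGraph.Walk.support_nil, List.mem_singleton] at hz; exact hz ▸ hv
  | u, _, SimpleGraph.Walk.cons (v := u') hadj W, hv => by
      rcases walk_avoid_or_lastExit D W hv with h | ⟨u₀, u₁, W', hu₀, hadj', hW'⟩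
      · by_cases hu : u ∈ D
        · exact Or.inr ⟨u, u', W, hu, hadj, h⟩
        · refine Or.inl fun z hz ↦ ?_
          rw [SimpleGraph.Walk.support_cons, List.mem_cons] at hz
          exact hz.elim (fun hz ↦ hz ▸ hu) (h z)
      · exact Or.inr ⟨u₀, u₁, W', hu₀, hadj', hW'⟩

/-- **First exit with an invariant.**  A walk of open LATTICE edges of `ω` (mesh `δ ≥ 0`) whose sites
satisfy `P`, from inside `B(x, R)` to outside, reaches some `w` with `R ≤ dist(δw, x)` inside
`{P} ∩ {dist ≤ R + 2δ}` through open edges of any `ω'` containing the open lattice edges of `ω`. -/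
theorem exists_exit_openConnIn_of_forall {ω ω' : BondConfig (Site 2)}
    (hω' : ∀ p q : Site 2, (zdGraph 2).Adj p q → s(p, q) ∈ ω → s(p, q) ∈ ω') {δ : ℝ} (hδ : 0 ≤ δ)
    (x : ℂ) (R : ℝ) (P : Site 2 → Prop) {u v : Site 2} (W : (openGraph ω ⊓ zdGraph 2).Walk u v)
    (hW : ∀ z ∈ W.support, P z) (hu : dist (meshPoint δ u) x < R) (hv : R ≤ dist (meshPoint δ v) x) :
    ∃ w : Site 2, R ≤ dist (meshPoint δ w) x ∧
      ω' ∈ openConnIn {s | P s ∧ dist (meshPoint δ s) x ≤ R + 2 * δ} u w := by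
  induction W with
  | nil => exact absurd hv (not_le.2 hu)
  | @cons p q _ hadj W ih =>
    have hadj' := (SimpleGraph.inf_adj _ _ _ _).1 hadj
    have hopen : s(p, q) ∈ ω' := hω' p q hadj'.2 ((openGraph_adj _ _ _).1 hadj'.1).1
    have hstep : dist (meshPoint δ q) x ≤ dist (meshPoint δ p) x + δ := by
      have h1 := norm_meshPoint_sub_meshPoint_le_of_adj δ hadj'.2
      rw [abs_of_nonneg hδ, ← dist_eq_norm] at h1
      linarith [dist_triangle (meshPoint δ q) (meshPoint δ p) x]
    have hWq : ∀ z ∈ W.support, P z := fun z hz ↦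
      hW z (by rw [SimpleGraph.Walk.support_cons]; exact List.mem_cons_of_mem _ hz)
    have hpS : p ∈ {s : Site 2 | P s ∧ dist (meshPoint δ s) x ≤ R + 2 * δ} :=
      ⟨hW p (SimpleGraph.Walk.start_mem_support _), by linarith⟩
    by_cases hq : R ≤ dist (meshPoint δ q) x
    · exact ⟨q, hq, openConnIn_of_adj hpS ⟨hWq q (SimpleGraph.Walk.start_mem_support _), by linarith⟩
        hopen hadj'.2.ne⟩
    · obtain ⟨w, hw, hconn⟩ := ih hWq (not_le.1 hq) hv
      obtain ⟨hqS, -, -⟩ := id hconn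
      exact ⟨w, hw, PlanarDuality.openConnIn_trans (openConnIn_of_adj hpS hqS hopen hadj'.2.ne) hconn⟩

/-- **Loop ⇒ CONFINED open arm on `δℤ²`** (`a + 4δ ≤ b`, `δ > 0`): every `ω'` containing the open
lattice edges of `ω` crosses from `B̄(x, a + 2δ)` to `{dist ≥ b − δ}` through sites of the annulus
`a + δ < dist ≤ b + δ` (rim walk of the loop, `IsInterfaceLoop.reachable_left`, trimmed twice). -/
theorem mem_openCrossing_annulus_of_isInterfaceLoop {ω ω' : BondConfig (Site 2)}
    (hω' : ∀ p q : Site 2, (zdGraph 2).Adj p q → s(p, q) ∈ ω → s(p, q) ∈ ω') {γ : List MedialVertex}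
    (h : IsInterfaceLoop ω γ) {δ : ℝ} (hδ : 0 < δ) (x : ℂ) {a b : ℝ} (hab : a + 4 * δ ≤ b) {z z' : ℂ}
    (hz : z ∈ (loopCurve δ 0 γ).range) (hz' : z' ∈ (loopCurve δ 0 γ).range) (hza : dist z x ≤ a)
    (hz'b : b ≤ dist z' x) :
    ω' ∈ openCrossing ZAnn(δ, x, a, b) {s : Site 2 | dist (meshPoint δ s) x ≤ a + 2 * δ}
      {s : Site 2 | b - δ ≤ dist (meshPoint δ s) x} := by
  obtain ⟨p, hp, hpz⟩ := exists_left_dist_le_mesh h δ hz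
  obtain ⟨q, hq, hqz⟩ := exists_left_dist_le_mesh h δ hz'
  rw [abs_of_pos hδ] at hpz hqz
  have hpa : dist (meshPoint δ p.1) x ≤ a + δ / 2 := by linarith [dist_triangle (meshPoint δ p.1) z x, dist_comm z (meshPoint δ p.1)]
  have hqb : b - δ / 2 ≤ dist (meshPoint δ q.1) x := by linarith [dist_triangle z' (meshPoint δ q.1) x]
  obtain ⟨W⟩ := h.reachable_left hp hq
  set D : Set (Site 2) := {s | dist (meshPoint δ s) x ≤ a + δ} with hD
  rcases walk_avoid_or_lastExit D W (fun h' ↦ by simp only [hD, mem_setOf_eq] at h'; linarith) with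
    havoid | ⟨u₀, u₁, W', hu₀, hadj, hW'⟩
  · exact absurd (show dist (meshPoint δ p.1) x ≤ a + δ by linarith) (havoid p.1 (SimpleGraph.Walk.start_mem_support _))
  have hadj' := (SimpleGraph.inf_adj _ _ _ _).1 hadj
  have hu₁ : dist (meshPoint δ u₁) x ≤ a + 2 * δ := by
    have h1 := norm_meshPoint_sub_meshPoint_le_of_adj δ hadj'.2
    rw [abs_of_pos hδ, ← dist_eq_norm] at h1
    simp only [hD, mem_setOf_eq] at hu₀
    linarith [dist_triangle (meshPoint δ u₁) (meshPoint δ u₀) x]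
  obtain ⟨w, hw, hconn⟩ := exists_exit_openConnIn_of_forall hω' hδ.le x (b - δ) (fun s ↦ a + δ < dist (meshPoint δ s) x)
    W' (fun s hs ↦ not_le.1 fun h' ↦ hW' s hs h') (by linarith) (by linarith)
  have hS : {s : Site 2 | a + δ < dist (meshPoint δ s) x ∧ dist (meshPoint δ s) x ≤ b - δ + 2 * δ} ⊆ ZAnn(δ, x, a, b) :=
    fun s hs ↦ ⟨hs.1, by linarith [hs.2]⟩
  exact mem_openCrossing_iff.2 ⟨u₁, hu₁, w, hw, openConnIn_mono hS _ _ hconn⟩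

/-- **The gap-crossing event of `zEns` lies in the confined crossing of the lattice part `ω ∩ E(ℤ²)`.** -/
theorem loopCross_subset_conf_zEns {δ : ℝ} (hδ : 0 < δ) (x : ℂ) {a b : ℝ} (hab : a + 4 * δ ≤ b) :
    LCross(zEns, δ, x, a, b) ⊆ ZConf(δ, x, a, b) := by
  rintro ω ⟨u, hu, ⟨z, hzu, hza⟩, ⟨z', hz'u, hz'b⟩⟩
  obtain ⟨⟨γ, hne⟩, h, rfl⟩ := (mem_loops_iff δ ω u).1 hu
  exact mem_openCrossing_annulus_of_isInterfaceLoop (fun p q hpq hω ↦ Set.mem_inter hω ((SimpleGraph.mem_edgeSet _).2 hpq))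
    h hδ x hab hzu hz'u (mem_closedBall.1 hza) (not_lt.1 hz'b)

/-- **The confined crossing of the lattice part implies the tree's RSW event**
`annulusOpenCrossing x δ (a + 2δ) (b − δ)` of `ω` (monotone in the confining set, increasing in `ω`). -/
theorem conf_subset_annulusOpenCrossing (δ : ℝ) (x : ℂ) (a b : ℝ) :
    ZConf(δ, x, a, b) ⊆ annulusOpenCrossing x δ (a + 2 * δ) (b - δ) := fun ω hω ↦
  isUpperSet_annulusOpenCrossing x δ _ _ Set.inter_subset_left (openCrossing_mono
    (fun s hs ↦ show dist (meshPoint δ s) x ≤ b - δ + 2 * δ by linarith [hs.2]) subset_rfl subset_rfl hω)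

/-- **The confined crossing of the lattice part is a cylinder event of the lattice edges of the
annulus**, hence measurable (`δ > 0`: finitely many annulus sites). -/
theorem determinedBy_conf_zEns {δ : ℝ} (hδ : 0 < δ) (x : ℂ) (a b : ℝ) :
    DeterminedBy ZConf(δ, x, a, b)
        {e : Sym2 (Site 2) | e ∈ (zdGraph 2).edgeSet ∧ ∀ s ∈ e, s ∈ ZAnn(δ, x, a, b)} ∧
      MeasurableSet ZConf(δ, x, a, b) := by
  have hfin : ZAnn(δ, x, a, b).Finite := (finite_setOf_dist_meshPoint_le hδ x (b + δ)).subset fun s hs ↦ hs.2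
  have hC := PlanarDuality.determinedBy_openCrossing hfin.toFinset {s : Site 2 | dist (meshPoint δ s) x ≤ a + 2 * δ}
    {s : Site 2 | b - δ ≤ dist (meshPoint δ s) x}
  have hmC := measurableSet_openCrossing hfin.toFinset {s : Site 2 | dist (meshPoint δ s) x ≤ a + 2 * δ}
    {s : Site 2 | b - δ ≤ dist (meshPoint δ s) x}
  rw [Set.Finite.coe_toFinset] at hC hmC
  have key : ∀ ω : BondConfig (Site 2), ω ∩ (zdGraph 2).edgeSet ∩ (↑hfin.toFinset.sym2 : Set _) =
      ω ∩ {e : Sym2 (Site 2) | e ∈ (zdGraph 2).edgeSet ∧ ∀ s ∈ e, s ∈ ZAnn(δ, x, a, b)} := fun ω ↦ by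
    ext e
    simp only [mem_inter_iff, Finset.mem_coe, Finset.mem_sym2_iff, Set.Finite.mem_toFinset, mem_setOf_eq, and_assoc]
  refine ⟨(determinedBy_iff _ _).2 fun ω ω' hωω' ↦ (determinedBy_iff _ _).1 hC _ _ ?_,
    hmC.preimage (measurable_set_iff.2 fun e ↦ (measurable_set_mem e).and measurable_const)⟩
  rw [key, key]; exact hωω'

/-! ## §2 Site-`𝕋`: the crossing loop gives an open crossing CONFINED to the annulus -/

/-- **Loop ⇒ CONFINED open arm on `δ𝕋`** (`a + 5δ ≤ b`, `δ > 0`): the open path of left sites of the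
loop (`IsSiteInterfaceLoop.pathIn_lv`), trimmed at its last visit to `B̄(z, a + δ)` and its first exit
from `B̄(z, b − 2δ)`, crosses from `‖·‖ < a + 3δ` to `‖·‖ > b − 2δ` through annulus sites. -/
theorem mem_conf_of_isSiteInterfaceLoop {ω : SiteConfig (Site 2)} {F : HexVertex}
    {γ : hexGraph.Walk F F} (hγ : IsSiteInterfaceLoop ω γ) {δ : ℝ} (hδ : 0 < δ) (z : ℂ) {a b : ℝ}
    (hab : a + 5 * δ ≤ b) {y y' : ℂ} (hy : y ∈ polyTrace δ γ) (hy' : y' ∈ polyTrace δ γ)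
    (hya : dist y z ≤ a) (hy'b : b ≤ dist y' z) : ω ∈ TConf(δ, z, a, b) := by
  obtain ⟨i, hi, hyi⟩ := mem_polyTrace_iff.1 hy
  obtain ⟨i', hi', hyi'⟩ := mem_polyTrace_iff.1 hy'
  have h1 : dist y (triMeshPoint δ (hγ.lv i)) ≤ δ := hγ.polyPiece_subset_closedBall hδ.le hi hyi
  have h2 : dist y' (triMeshPoint δ (hγ.lv i')) ≤ δ := hγ.polyPiece_subset_closedBall hδ.le hi' hyi'
  have hstep : ∀ {s s' : Site 2}, triGraph.Adj s s' →
      dist (triMeshPoint δ s') z ≤ dist (triMeshPoint δ s) z + δ := fun {s s'} hss' ↦ by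
    have hd : dist (triMeshPoint δ s) (triMeshPoint δ s') = δ := by
      rw [triMeshPoint, triMeshPoint, dist_eq_norm, ← mul_sub, norm_mul, Complex.norm_real,
        Real.norm_eq_abs, abs_of_pos hδ, (triGraph_adj_iff_dist_holds _ _).1 hss', mul_one]
    linarith [dist_triangle (triMeshPoint δ s') (triMeshPoint δ s) z, dist_comm (triMeshPoint δ s) (triMeshPoint δ s')]
  set D : Set (Site 2) := {s | dist (triMeshPoint δ s) z ≤ a + δ} with hD
  have hiD : hγ.lv i ∈ D := show dist (triMeshPoint δ (hγ.lv i)) z ≤ a + δ by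
    linarith [dist_triangle (triMeshPoint δ (hγ.lv i)) y z, dist_comm y (triMeshPoint δ (hγ.lv i))]
  have hfar : b - δ ≤ dist (triMeshPoint δ (hγ.lv i')) z := by linarith [dist_triangle y' (triMeshPoint δ (hγ.lv i')) z]
  obtain ⟨u₀, u₁, hu₀, -, -, hadj, hP⟩ := ((hγ.pathIn_lv hi).symm.trans (hγ.pathIn_lv hi')).last_exit
    hiD (fun h' ↦ by simp only [hD, mem_setOf_eq] at h'; linarith)
  have hu₁a : dist (triMeshPoint δ u₁) z ≤ a + 2 * δ := by simp only [hD, mem_setOf_eq] at hu₀; linarith [hstep hadj]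
  set Rset : Set (Site 2) := {s | dist (triMeshPoint δ s) z ≤ b - 2 * δ} with hRset
  have hu₁R : u₁ ∈ Rset := show dist (triMeshPoint δ u₁) z ≤ b - 2 * δ by linarith
  obtain ⟨a₂, b₂, ha₂, hb₂, hb₂A, hadj₂, hP₂⟩ := hP.exit hu₁R
    (fun h' ↦ by simp only [hRset, mem_setOf_eq] at h'; linarith)
  have hsub : Rset ∩ (ω \ D) ⊆ {s | s ∈ ω ∧ a + δ < dist (triMeshPoint δ s) z ∧
      dist (triMeshPoint δ s) z ≤ b - δ} := fun s hs ↦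
    ⟨hs.2.1, not_le.1 hs.2.2, by have := hs.1; simp only [hRset, mem_setOf_eq] at this; linarith⟩
  have hb₂T : b₂ ∈ {s | s ∈ ω ∧ a + δ < dist (triMeshPoint δ s) z ∧ dist (triMeshPoint δ s) z ≤ b - δ} := by
    refine ⟨hb₂A.1, not_le.1 hb₂A.2, ?_⟩
    simp only [hRset, mem_setOf_eq] at ha₂; linarith [hstep hadj₂]
  obtain ⟨W, hW⟩ := ((hP₂.mono hsub).tail hadj₂ hb₂T).exists_walk
  refine ⟨u₁, b₂, W, ?_, ?_, fun s hs ↦ ?_⟩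
  · rw [← dist_eq_norm]; linarith
  · rw [← dist_eq_norm]; simp only [hRset, mem_setOf_eq, not_le] at hb₂; linarith
  · obtain ⟨h₁, h₂, h₃⟩ := hW s hs
    exact ⟨h₁, by rwa [← dist_eq_norm], by rwa [← dist_eq_norm]⟩

/-- **The gap-crossing event of `tEns` lies in the confined crossing** (`a + 5δ ≤ b`), which lies in the
tree's RSW event `triAnnulusCrossing true δ z (a + 3δ) (b − 2δ)`. -/
theorem loopCross_subset_conf_tEns {δ : ℝ} (hδ : 0 < δ) (z : ℂ) {a b : ℝ} (hab : a + 5 * δ ≤ b) :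
    LCross(tEns, δ, z, a, b) ⊆ TConf(δ, z, a, b) ∧
      TConf(δ, z, a, b) ⊆ triAnnulusCrossing true δ z (a + 3 * δ) (b - 2 * δ) := by
  refine ⟨?_, fun ω ⟨p, q, w, hp, hq, hw⟩ ↦ ⟨p, q, w, hp, hq, fun s hs ↦ ⟨fun _ ↦ rfl, fun _ ↦ (hw s hs).1⟩⟩⟩
  rintro ω ⟨u, hu, ⟨y, hyu, hya⟩, ⟨y', hy'u, hy'b⟩⟩
  obtain ⟨⟨F, γ⟩, hγ, rfl⟩ := (mem_loops_siteLoopConfig_iff δ ω u).1 hu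
  have hγ' : IsSiteInterfaceLoop ω γ := hγ
  have hr : (UnbasedLoop.mk (BasedLoop.mk (siteLoopCurve δ γ) (isLoop_siteLoopCurve δ γ))).range =
      polyTrace δ γ := by
    rw [range_mk_siteLoopCurve]
    exact range_toCurve_eq_polyTrace (by have := hγ'.isCycle.three_le_length; omega)
  simp only at hyu hy'u
  rw [hr] at hyu hy'u
  exact mem_conf_of_isSiteInterfaceLoop hγ' hδ z hab hyu hy'u (mem_closedBall.1 hya) (not_lt.1 hy'b)

/-- **The confined crossing of `δ𝕋` is a cylinder event of the annulus sites**, hence measurable. -/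
theorem determinedBy_conf_tEns {δ : ℝ} (hδ : 0 < δ) (z : ℂ) (a b : ℝ) :
    DeterminedBy TConf(δ, z, a, b) TAnn(δ, z, a, b) ∧ MeasurableSet TConf(δ, z, a, b) := by
  have key : ∀ ω ω' : SiteConfig (Site 2), ω ∩ TAnn(δ, z, a, b) = ω' ∩ TAnn(δ, z, a, b) →
      ∀ s : Site 2, a + δ < ‖triMeshPoint δ s - z‖ → ‖triMeshPoint δ s - z‖ ≤ b - δ → s ∈ ω → s ∈ ω' :=
    fun ω ω' h s h₁ h₂ hs ↦ ((Set.ext_iff.1 h s).1 ⟨hs, h₁, h₂⟩).1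
  have hdet : DeterminedBy TConf(δ, z, a, b) TAnn(δ, z, a, b) := by
    rw [determinedBy_iff]
    intro ω ω' h
    constructor
    · rintro ⟨p, q, w, hp, hq, hw⟩
      exact ⟨p, q, w, hp, hq, fun s hs ↦ ⟨key ω ω' h s (hw s hs).2.1 (hw s hs).2.2 (hw s hs).1, (hw s hs).2⟩⟩
    · rintro ⟨p, q, w, hp, hq, hw⟩
      exact ⟨p, q, w, hp, hq, fun s hs ↦ ⟨key ω' ω h.symm s (hw s hs).2.1 (hw s hs).2.2 (hw s hs).1, (hw s hs).2⟩⟩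
  have hfin : TAnn(δ, z, a, b).Finite := (finite_setOf_dist_triMeshPoint_le hδ z (b - δ)).subset fun s hs ↦ by
    show dist (triMeshPoint δ s) z ≤ b - δ; rw [dist_eq_norm]; exact hs.2
  refine ⟨hdet, ?_⟩
  rw [← hfin.coe_toFinset] at hdet
  exact hdet.measurableSet_of_finset

/-! ## §3 Independence from window observables: the TILTED rarity of gap crossings -/

/-- **Factorisation under independence**: an integrable observable independent of the indicator of a
measurable event integrates over the event to `(∫ φ) · P(event)`. -/
theorem setIntegral_eq_mul_of_indepFun {Ω : Type*} [MeasurableSpace Ω] {P : Measure Ω} {C : Set Ω}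
    (hC : MeasurableSet C) {φ : Ω → ℝ} (hφm : Measurable φ)
    (hind : IndepFun φ (C.indicator fun _ ↦ (1 : ℝ)) P) :
    ∫ ω in C, φ ω ∂P = (∫ ω, φ ω ∂P) * P.real C := by
  calc ∫ ω in C, φ ω ∂P = ∫ ω, φ ω * C.indicator (fun _ ↦ (1 : ℝ)) ω ∂P := by
        rw [← integral_indicator hC]
        refine integral_congr_ae (Eventually.of_forall fun ω ↦ ?_)
        by_cases h : ω ∈ C
        · simp only [Set.indicator_of_mem h, mul_one]
        · simp only [Set.indicator_of_notMem h, mul_zero]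
    _ = (∫ ω, φ ω ∂P) * ∫ ω, C.indicator (fun _ ↦ (1 : ℝ)) ω ∂P :=
        hind.integral_fun_mul_eq_mul_integral hφm.aestronglyMeasurable (measurable_const.indicator hC).aestronglyMeasurable
    _ = (∫ ω, φ ω ∂P) * P.real C := by rw [← integral_indicator_one hC]; rfl

/-- The indicator of an event determined by `G` is unchanged by `ω ↦ ω ∩ G`. -/
theorem indicator_inter_eq_of_determinedBy {ι : Type*} {C : Set (Set ι)} {G : Set ι}
    (h : DeterminedBy C G) (ω : Set ι) :
    C.indicator (fun _ ↦ (1 : ℝ)) (ω ∩ G) = C.indicator (fun _ ↦ (1 : ℝ)) ω := by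
  have key : ω ∩ G ∈ C ↔ ω ∈ C := (determinedBy_iff _ _).1 h (ω ∩ G) ω (by rw [Set.inter_assoc, Set.inter_self])
  by_cases hω : ω ∈ C
  · rw [Set.indicator_of_mem hω, Set.indicator_of_mem (key.2 hω)]
  · rw [Set.indicator_of_notMem hω, Set.indicator_of_notMem fun h' ↦ hω (key.1 h')]

/-- **The bound from confinement, independence and RSW** (common tail of both lattices): if the
gap-crossing event lies in an event `C` with `∫_C φ = (∫ φ) P(C)` and `P(C) ≤ q^α`, `q ≤ 4(a/b)`,
then `∫_{gap crossed} φ ≤ 4^α (a/b)^α ∫ φ` for `φ ≥ 0` integrable. -/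
theorem setIntegral_le_of_factor {Ω : Type*} [MeasurableSpace Ω] {P : Measure Ω} {L C : Set Ω}
    {φ : Ω → ℝ} (hφi : Integrable φ P) (hφ0 : ∀ ω, 0 ≤ φ ω) (hLC : L ⊆ C)
    (hfac : ∫ ω in C, φ ω ∂P = (∫ ω, φ ω ∂P) * P.real C) {α q a b : ℝ} (hα : 0 ≤ α) (hq0 : 0 ≤ q)
    (hab : 0 ≤ a / b) (hPC : P.real C ≤ q ^ α) (hq : q ≤ 4 * (a / b)) :
    ∫ ω in L, φ ω ∂P ≤ 4 ^ α * (a / b) ^ α * ∫ ω, φ ω ∂P := by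
  have hint0 : 0 ≤ ∫ ω, φ ω ∂P := integral_nonneg hφ0
  calc ∫ ω in L, φ ω ∂P ≤ ∫ ω in C, φ ω ∂P :=
        setIntegral_mono_set hφi.integrableOn (ae_restrict_of_ae (Eventually.of_forall hφ0)) hLC.eventuallyLE
    _ = (∫ ω, φ ω ∂P) * P.real C := hfac
    _ ≤ (∫ ω, φ ω ∂P) * (4 ^ α * (a / b) ^ α) := by
        refine mul_le_mul_of_nonneg_left (hPC.trans ?_) hint0
        rw [← Real.mul_rpow (by norm_num) hab]; exact Real.rpow_le_rpow hq0 hq hα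
    _ = 4 ^ α * (a / b) ^ α * ∫ ω, φ ω ∂P := by ring

/-- **Tilted rarity of gap crossings on bond-`ℤ²`, for every observable of the complement of the
annulus**: if `φ ≥ 0` is integrable, measurable and determined by a set `M` of edges disjoint from the
lattice edges of the annulus (`φ(ω ∩ M) = φ(ω)`; e.g. towers inside the hole or outside the annulus),
then `∫_{gap crossed} φ ≤ C (a/b)^c ∫ φ`, with constants chosen BEFORE `φ` (independence of cylinder
events of disjoint edge sets, `TowerIndependence.indepFun_of_determined_zEns`, and RSW). -/
theorem setIntegral_loopCross_le_zEns : ∃ c C c₀ : ℝ, 0 < c ∧ 0 < C ∧ 0 < c₀ ∧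
    ∀ (x : ℂ) (a b δ : ℝ), 0 < δ → c₀ * δ ≤ a → 4 * a ≤ b →
      ∀ (M : Set (Sym2 (Site 2))) (φ : BondConfig (Site 2) → ℝ),
        Disjoint M {e : Sym2 (Site 2) | e ∈ (zdGraph 2).edgeSet ∧ ∀ s ∈ e, s ∈ ZAnn(δ, x, a, b)} →
        Measurable φ → Integrable φ zEns.P → (∀ ω, 0 ≤ φ ω) → (∀ ω, φ (ω ∩ M) = φ ω) →
        ∫ ω in LCross(zEns, δ, x, a, b), φ ω ∂zEns.P ≤ C * (a / b) ^ c * ∫ ω, φ ω ∂zEns.P := by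
  haveI : IsProbabilityMeasure zEns.P := inferInstanceAs (IsProbabilityMeasure (bondPercolation (zdGraph 2) half))
  obtain ⟨α, c₀, hα, hc₀, hbd⟩ := annulusOpenCrossing_half_le_holds
  refine ⟨α, 4 ^ α, max c₀ 4, hα, by positivity, by positivity, fun x a b δ hδ ha h4 M φ hdisj hφm hφi hφ0 hφ ↦ ?_⟩
  have hδa : 4 * δ ≤ a := le_trans (mul_le_mul_of_nonneg_right (le_max_right c₀ 4) hδ.le) ha
  have hc₀a : c₀ * δ ≤ a := le_trans (mul_le_mul_of_nonneg_right (le_max_left c₀ 4) hδ.le) ha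
  have hb0 : 0 < b := by linarith
  obtain ⟨hdet, hCm⟩ := determinedBy_conf_zEns hδ x a b
  have hind := TowerIndependence.indepFun_of_determined_zEns hdisj hφm (measurable_const.indicator hCm) hφ
    (indicator_inter_eq_of_determinedBy hdet)
  refine setIntegral_le_of_factor hφi hφ0 (loopCross_subset_conf_zEns hδ x (by linarith))
    (setIntegral_eq_mul_of_indepFun hCm hφm hind) hα.le (div_nonneg (by linarith) (by linarith))
    (div_nonneg (by linarith) hb0.le) ((measureReal_mono (conf_subset_annulusOpenCrossing δ x a b)).trans
      (hbd x δ (a + 2 * δ) (b - δ) hδ (by linarith) (by linarith))) ?_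
  rw [mul_div_assoc', div_le_div_iff₀ (by linarith) hb0]
  nlinarith

/-- **Tilted rarity of gap crossings on site-`𝕋`, for every observable of the complement of the annulus**
(determined by a set `S` of sites disjoint from the annulus sites; `tri_annulusCrossing_bound_holds`). -/
theorem setIntegral_loopCross_le_tEns : ∃ c C c₀ : ℝ, 0 < c ∧ 0 < C ∧ 0 < c₀ ∧
    ∀ (x : ℂ) (a b δ : ℝ), 0 < δ → c₀ * δ ≤ a → 4 * a ≤ b →
      ∀ (S : Set (Site 2)) (φ : SiteConfig (Site 2) → ℝ), Disjoint S TAnn(δ, x, a, b) →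
        Measurable φ → Integrable φ tEns.P → (∀ ω, 0 ≤ φ ω) → (∀ ω, φ (ω ∩ S) = φ ω) →
        ∫ ω in LCross(tEns, δ, x, a, b), φ ω ∂tEns.P ≤ C * (a / b) ^ c * ∫ ω, φ ω ∂tEns.P := by
  haveI : IsProbabilityMeasure tEns.P := inferInstanceAs (IsProbabilityMeasure (triSitePercolation half))
  obtain ⟨α, hα, hbd⟩ := tri_annulusCrossing_bound_holds
  refine ⟨α, 4 ^ α, 1000, hα, by positivity, by norm_num, fun x a b δ hδ ha h4 S φ hdisj hφm hφi hφ0 hφ ↦ ?_⟩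
  have hb0 : 0 < b := by linarith
  obtain ⟨hdet, hCm⟩ := determinedBy_conf_tEns hδ x a b
  have hind := TowerIndependence.indepFun_of_determined_tEns hdisj hφm (measurable_const.indicator hCm) hφ
    (indicator_inter_eq_of_determinedBy hdet)
  obtain ⟨hLC, hCT⟩ := loopCross_subset_conf_tEns hδ x (a := a) (b := b) (by linarith)
  refine setIntegral_le_of_factor hφi hφ0 hLC (setIntegral_eq_mul_of_indepFun hCm hφm hind) hα.le
    (div_nonneg (by linarith) (by linarith)) (div_nonneg (by linarith) hb0.le)
    ((measureReal_mono hCT).trans (hbd true δ x (a + 3 * δ) (b - 2 * δ) hδ (by linarith) (by linarith))) ?_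
  rw [mul_div_assoc', div_le_div_iff₀ (by linarith) hb0]
  nlinarith

/-- **Towers inside the hole are observables of the complement of the annulus** (bond-`ℤ²`): the edges
with medial point in `B(x, R)`, `R ≤ a`, miss the lattice edges with both endpoints beyond `a + δ`. -/
theorem disjoint_window_annulus_zEns {δ : ℝ} (hδ : 0 < δ) (x : ℂ) {a R : ℝ} (hRa : R ≤ a) (b ρ : ℝ) :
    Disjoint {e : Sym2 (Site 2) | medialPoint δ e ∈ ball x R \ closedBall x ρ}
      {e : Sym2 (Site 2) | e ∈ (zdGraph 2).edgeSet ∧ ∀ s ∈ e, s ∈ ZAnn(δ, x, a, b)} := by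
  refine Set.disjoint_left.2 fun e heM ⟨hE, hS⟩ ↦ ?_
  have hm : dist (medialPoint δ e) x ≤ a := (mem_ball.1 heM.1).le.trans hRa
  revert hE hS hm
  refine Sym2.ind (fun p q hE hS hm ↦ ?_) e
  have h1 := dist_meshPoint_medialPoint_le (δ := δ) ((SimpleGraph.mem_edgeSet _).1 hE) (Sym2.mem_mk_left p q)
  rw [abs_of_pos hδ] at h1
  linarith [(hS p (Sym2.mem_mk_left p q)).1, dist_triangle (meshPoint δ p) (medialPoint δ s(p, q)) x]

end GapCrossing

/-! ## §4 Both lattice ensembles (registered anchor) -/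

/-- **Tilted rarity of gap crossings on BOTH lattice ensembles** (registered helper toward stub R2'
`stub_staircaseDecoupling`, line `ring-cloud-tomography` r4: input (G) under the tower tilt).  For
`E ∈ latticeEnsembles` there are `c, C, c₀ > 0` such that for every centre `x`, mesh `δ > 0`, radii with
`c₀ δ ≤ a`, `4a ≤ b`, weight `u ≥ 0` and window `(x, ρ, R)` with `R ≤ a`,
`∫_{some loop of X_δ meets B̄(x,a) and ℂ ∖ B(x,b)} u^{N_x(ρ,R)} dE.P ≤ C (a/b)^c ∫ u^{N_x(ρ,R)} dE.P`:
the gap-crossing event lies in an open crossing confined to the annulus, a cylinder event of the annulus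
coordinates, independent of the window tower (cylinder property `TowerIndependence.towerCount_zEns_inter`
/ `…_tEns_inter`) and rare by the tree's proved RSW bounds. -/
theorem setIntegral_pow_towerCount_loop_cross_le_latticeEnsembles : ∀ E ∈ latticeEnsembles,
    ∃ c C c₀ : ℝ, 0 < c ∧ 0 < C ∧ 0 < c₀ ∧ ∀ (x : ℂ) (a b δ u ρ R : ℝ), 0 < δ → c₀ * δ ≤ a →
      4 * a ≤ b → 0 ≤ u → R ≤ a →
      ∫ ω in {ω | ∃ v ∈ (E.X δ ω).loops, (v.range ∩ Metric.closedBall x a).Nonempty ∧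
          (v.range ∩ (Metric.ball x b)ᶜ).Nonempty}, u ^ towerCount (E.X δ ω) x ρ R ∂E.P ≤
        C * (a / b) ^ c * ∫ ω, u ^ towerCount (E.X δ ω) x ρ R ∂E.P := by
  intro E hE
  simp only [latticeEnsembles, Set.mem_insert_iff, Set.mem_singleton_iff] at hE
  rcases hE with rfl | rfl
  · obtain ⟨c, C, c₀, hc, hC, hc₀, h⟩ := GapCrossing.setIntegral_loopCross_le_zEns
    refine ⟨c, C, c₀, hc, hC, hc₀, fun x a b δ u ρ R hδ ha hab hu hRa ↦ h x a b δ hδ ha hab _ _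
      (GapCrossing.disjoint_window_annulus_zEns hδ x hRa b ρ) ((measurable_towerCount zEns zEns_mem δ x ρ R).const_pow u)
      (ConeTilt.integrable_pow_towerCount_of_nonneg zEns zEns_mem u hδ x ρ R hu) (fun ω ↦ pow_nonneg hu _)
      fun ω ↦ congrArg (u ^ ·) (TowerIndependence.towerCount_zEns_inter δ ω _ x ρ R fun _ he ↦ he)⟩
  · obtain ⟨c, C, c₀, hc, hC, hc₀, h⟩ := GapCrossing.setIntegral_loopCross_le_tEns
    refine ⟨c, C, c₀, hc, hC, hc₀, fun x a b δ u ρ R hδ ha hab hu hRa ↦ h x a b δ hδ ha hab _ _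
      (Set.disjoint_left.2 fun s hs hs' ↦ ?_) ((measurable_towerCount tEns tEns_mem δ x ρ R).const_pow u)
      (ConeTilt.integrable_pow_towerCount_of_nonneg tEns tEns_mem u hδ x ρ R hu) (fun ω ↦ pow_nonneg hu _)
      fun ω ↦ congrArg (u ^ ·) (TowerIndependence.towerCount_tEns_inter hδ.le ω _ x ρ R fun _ hs ↦ hs)⟩
    exact absurd (mem_ball.1 hs.1) (by rw [dist_eq_norm]; linarith [hs'.1])

end Summit.CriticalPhenomena.CardyFormulaZ2.Cruxes.NestingRigidity.RingCloudTomography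

end
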